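import Summits.QuantumFields.BalabanUV.T4Continuum.Support.InsertionChannelFamilyLinear

/-!
# InsertionChannelFamilyLinearBinders — the channel road CARRIED TO ROAD D, part 4: ALL kernel insertion binders of leaf-02's family
# model (`InsAffine`, `InsHomog`, `InsBlind` — EXACT on all tables — and MI-3a) for per-background slots whose run-A insertion is part 3's
# LINEAR-EXTENSION channel insertion `insLinOfChannel`; toy contrast with part 2's `toy_not_insAffine`
# (cell `pub-balaban`, T⁴ fan-out; row NE5, node U3; `HOME/t4/formal/NE5/LEAVES.md` row O1-c follower; INTENT in `HOME/CLAIMS.log`)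

Unit `b2b-balaban-t4-ne5-formalise-leaf-06` (NE5 formalisation swarm, leaf prover 06, gen 12).  Summits-side NEW WORK under the
LEAN PLACEMENT RULE (cell modelling + bookkeeping over ABSTRACT carriers; nothing of the manuscripts under audit is asserted; 0 cite
tags; no `Prop`-valued fact minted — trigger c3).  HONEST FRAMING: rung (B)+1 of the FINITE-VOLUME T⁴ continuum programme — NOT
infinite volume, NOT a mass gap, NOT the Clay problem, NOT a proof of NE5 (NOT PRINTED; cell GAPS G-t4-U3-1) nor of NE9; spine 0/9;
0/12 leaves instantiated on Bałaban's concrete objects (O1 = the substrate cell, owner R34).  HONEST DEPENDENCY (cell line,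
verbatim): continuum YM on T⁴ ⇐ BetaPertH ∧ nine spine estimates (0/9 proved); BetaPertH ⇐ (D1) ∧ (D4) ∧ CAP+tail; G-an2-4 gates
asym, D1 and NE2/3/4.

WHAT THIS FILE TYPES ([folklore] bookkeeping on part 3; 0 sorry; row NE9's shapes enter BY NAME as displayed hypotheses, none discharged):
* §1 per chart point, ON ALL TABLES and EXACT: `insLin_affine_pointwise`, `insLin_homog_pointwise`, `insLin_eq_of_agree` (`ChannelLocal
  univ`); `norm_insLin_sub_le` (the per-point MI-3a bound: the kernel's hypotheses make `t − t′` GOOD, so the good parts differ by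
  `t − t′` exactly and part 1's `norm_insAt_sub_le` applies).  For leaf-02's `PointwiseSlots P` with
  `hins : P.insA g k t u = insLinOfChannel … g k t u` on `W`: **`insAffine_of_insLin : P.toStepModel.InsAffine W`**,
  **`insHomog_of_insLin`**, **`insBlind_of_insLin`** (exact), `insertionDampedNat_pointwise_of_insLin` ∕ `insertionDamped_pointwise_of_insLin`
  (the per-point `hdamp` shapes — the latter EXACTLY the `hdamp` binder of `PointwiseSlots.ne5_of_pointwiseSlots`, gain `c∕ω`),
  `insertionDampedNat_of_insLin` (model level).  With these, EVERY END face of record — including those carrying the structural binders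
  `InsAffine ∧ InsBlind ∧ InsHomog` (E1′ `T4InputCauchyRateData.StepModel.ne5_at_of_stepModel_fibre_scale_nat` and its descendants) —
  applies on Road D to a channel-reading family model; the remaining size shapes are CONTAINED in MI-3a (generic `StepModel` algebra,
  §1b: `stepModel_sizeDampedNat_of_insertionDampedNat`, `stepModel_insScaleBoundLevel_of_insertionDampedNat`,
  `stepModel_insScaleBound_of_insScaleBoundLevel` — the `StepModel` twins of `T4ActivityRecursion.InputModel`'s lemmas of the same names).
* END `ne5_of_pointwiseSlots_insLin_fibre_scale_nat` = E1′ (`StepModel.ne5_at_of_stepModel_fibre_scale_nat`, the face CARRYING the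
  structural binders) on `P.toStepModel` ∘ `ne5_of_ne5_lift`: conclusion LITERALLY `T4OutputRate.NE5 EA EB W κ θ′ C₅`, E1′'s constant —
  the face that is unusable for the junk-valued insertion.
* §2 TOY: part 2's `toyChannel` over the infinite chart `ℕ` (homogeneous, `toyChannel_homog`) through the linear extension:
  `toySlotsLin`, **`toySlotsLin_insAffine`** (HOLDS — contrast part 2's `toy_not_insAffine` for the junk-valued insertion of the SAME channel
  over the SAME chart), `toySlotsLin_binders` (`InsHomog ∧ InsBlind ∧ InsertionDampedNat univ 0 1 1`).
NOT IN THIS FILE.  The retraction of part 3 is non-constructive and non-canonical; no instance on Bałaban's objects; no NE9 binder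
discharged; no W1 ∕ W2; no estimate of [II].  Headline wording: «NE5 channel road carried to Road D — structural binders restored by a
linear extension; junction only»; never «leaf instantiated».  NE5 NOT PROVED; NE9 NOT PROVED; spine 0/9; rung (B)+1 finite T⁴; NOT
infinite volume ∕ mass gap ∕ Clay.  Axioms ⊆ {propext, Classical.choice, Quot.sound}.
-/

noncomputable section

open scoped BigOperators
open Finset Function Metric Set

namespace Summit.QuantumFields.BalabanUV.T4Continuum.InsertionChannelFamily

open Literature.MathematicalPhysics.QuantumFieldTheory.Balaban1983to89
open Literature.MathematicalPhysics.QuantumFieldTheory.Balaban1983to89.T4OutputRate (Carriers)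
open Literature.MathematicalPhysics.QuantumFieldTheory.Balaban1983to89.T4InputCauchyRate (toyCarriers)
open Literature.MathematicalPhysics.QuantumFieldTheory.Balaban1983to89.T4InputCauchyRateData (StepModel mul_sum_age_shift)
open Literature.MathematicalPhysics.QuantumFieldTheory.Balaban1983to89.T4HistoryLipschitzRecursion
  (ChannelAdditive ChannelLocal ChannelStepSum ChannelSizeAtStepNN truncScale)
open Summit.QuantumFields.BalabanUV.T4Continuum.B13HistDatum (HistFrame Hist)
open Summit.QuantumFields.BalabanUV.T4Continuum.InsertionChannelReading (ChannelHomog read_sub read_smul eq_of_read_eq)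
open Summit.QuantumFields.BalabanUV.T4Continuum.InsertionChannelInstance (tableOf read_tableOf)
open Summit.QuantumFields.BalabanUV.T4Continuum.OutputRateFunctionalTables
open Summit.QuantumFields.BalabanUV.T4Continuum.OutputRateFunctionalTablesFamily (Fam famOf famOf_apply toBgFamily norm_famOf_sub_famOf_le)
open Summit.QuantumFields.BalabanUV.T4Continuum.OutputRateFunctionalTablesPointwise (PointwiseSlots)

variable {C : Carriers} {𝒰 ι : Type} {F : HistFrame C}

/-! ## §1 All kernel insertion binders for per-background slots whose run-A insertion is the linear-extension insertion -/

section Binders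

variable {T : ℕ → (ℕ → ℝ) → (𝒰 → C.Dom → ℝ) → ι → ℝ}
variable (hadd : ChannelAdditive (Set.univ : Set (𝒰 → C.Dom → ℝ)) T) (hhom : ChannelHomog (Set.univ : Set (𝒰 → C.Dom → ℝ)) T)
  (out : 𝒰 → F.Idx → ι)

/-- [folklore] **AFFINE AT EVERY CHART POINT, ON ALL TABLES** (exact): differences of inserted histories depend only on the difference of
the tables — read-out by read-out, linearity of the retraction and of the channel. -/
theorem insLin_affine_pointwise (g : ℕ → ℝ) (k : ℕ) (t t' : C.Dom × 𝒰 → ℝ) (u : 𝒰) :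
    insLinOfChannel hadd hhom out g k t u - insLinOfChannel hadd hhom out g k t' u =
      insLinOfChannel hadd hhom out g k (t - t') u - insLinOfChannel hadd hhom out g k 0 u := by
  cases k with
  | zero => simp
  | succ k =>
    refine eq_of_read_eq fun i => ?_
    rw [read_sub, read_sub, read_insLin_succ, read_insLin_succ, read_insLin_succ, read_insLin_succ, goodPart_sub, goodPart_zero,
      toBgFamily_sub, hadd k g _ (Set.mem_univ _) _ (Set.mem_univ _) (out u i), show toBgFamily (0 : C.Dom × 𝒰 → ℝ) = 0 from rfl,
      channel_zero T hadd]
    push_cast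
    ring

/-- [folklore] **HOMOGENEOUS AT EVERY CHART POINT, ON ALL TABLES** (exact). -/
theorem insLin_homog_pointwise (g : ℕ → ℝ) (k : ℕ) (a : ℝ) (t : C.Dom × 𝒰 → ℝ) (u : 𝒰) :
    insLinOfChannel hadd hhom out g k (a • t) u - insLinOfChannel hadd hhom out g k 0 u =
      (a : ℂ) • (insLinOfChannel hadd hhom out g k t u - insLinOfChannel hadd hhom out g k 0 u) := by
  cases k with
  | zero => simp
  | succ k =>
    refine eq_of_read_eq fun i => ?_
    rw [read_smul, read_sub, read_sub, read_insLin_succ, read_insLin_succ, read_insLin_succ, goodPart_smul, goodPart_zero,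
      show toBgFamily (a • goodPart hadd hhom out k g t) = a • toBgFamily (goodPart hadd hhom out k g t) from rfl,
      hhom k g _ (Set.mem_univ _) a (out u i), show toBgFamily (0 : C.Dom × 𝒰 → ℝ) = 0 from rfl, channel_zero T hadd]
    push_cast
    ring

/-- [folklore] **BLIND ABOVE THE STEP, ON ALL TABLES** (exact; `ChannelLocal univ T`): tables agreeing on the scales `< k` have good parts
agreeing there (their difference is good, hence fixed by the retraction), so part 1's `insAt_eq_of_agree` applies. -/
theorem insLin_eq_of_agree (hloc : ChannelLocal (Set.univ : Set (𝒰 → C.Dom → ℝ)) T) (g : ℕ → ℝ) (k : ℕ)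
    {t t' : C.Dom × 𝒰 → ℝ} (h : ∀ Y, C.scale Y < k → ∀ u, t (Y, u) = t' (Y, u)) (u : 𝒰) :
    insLinOfChannel hadd hhom out g k t u = insLinOfChannel hadd hhom out g k t' u := by
  cases k with
  | zero => rfl
  | succ k =>
    have hmem := sub_mem_goodTables_of_agree hadd hhom out hloc g (k := k) (t := t) (t' := t')
      fun Y hY u => h Y (Nat.lt_succ_of_le hY) u
    have hdiff : goodPart hadd hhom out k g t - goodPart hadd hhom out k g t' = t - t' := by
      rw [← goodPart_sub, goodPart_of_mem hadd hhom out hmem]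
    rw [insLinOfChannel_succ, insLinOfChannel_succ, ← insAtOfChannel_succ, ← insAtOfChannel_succ]
    refine insAt_eq_of_agree hloc (k + 1) g (fun Y hY u' => ?_) u
    have := congrFun hdiff (Y, u')
    simp only [Pi.sub_apply] at this
    have h' := h Y hY u'
    linarith

/-- [folklore] **THE PER-CHART-POINT MI-3a BOUND FOR THE LINEAR-EXTENSION INSERTION** (Nat normalisation): the difference `t − t′` obeying
the kernel's hypotheses is good, hence the good parts differ by `t − t′` exactly and part 1's `norm_insAt_sub_le` applies to them. -/
theorem norm_insLin_sub_le {κ c ω : ℝ} {wt : ℕ → ι → ℝ} {τ : ℕ → ℕ → ℝ} {rH : ℕ → ℝ}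
    (hsum : ChannelStepSum (Set.univ : Set (𝒰 → C.Dom → ℝ)) T) (hsize : ChannelSizeAtStepNN (Set.univ : Set (𝒰 → C.Dom → ℝ)) T κ wt τ)
    (hwt0 : ∀ k u i, 0 ≤ wt k (out u i)) (hwt : ∀ k u i, wt k (out u i) ≤ rH (k + 1) * F.wt i)
    (hτ : ∀ k j, j ≤ k → τ k j ≤ c * ω ^ (k - j)) (hc : 0 ≤ c) (hω : 0 ≤ ω) (hrH : ∀ k, 0 ≤ rH k) (k : ℕ) (g : ℕ → ℝ)
    {t t' : C.Dom × 𝒰 → ℝ} {D : ℕ → ℝ} (hD : ∀ j < k, 0 ≤ D j)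
    (hb : ∀ Y, C.scale Y < k → ∀ u, |t (Y, u) - t' (Y, u)| ≤ D (C.scale Y) * Real.exp (-(κ * C.d Y))) (u : 𝒰) :
    ‖insLinOfChannel hadd hhom out g k t u - insLinOfChannel hadd hhom out g k t' u‖ ≤
      rH k * (c * ∑ j ∈ range k, ω ^ (k - 1 - j) * D j) := by
  cases k with
  | zero => simp [insLinOfChannel]
  | succ k =>
    have hmem : t - t' ∈ goodTables hadd hhom out k g :=
      mem_goodTables_of_bound hadd hhom out hsum hsize hwt0 hwt g (fun j hj => hD j (Nat.lt_succ_of_le hj))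
        fun Y hY u => by simpa only [Pi.sub_apply] using hb Y (Nat.lt_succ_of_le hY) u
    have hdiff : goodPart hadd hhom out k g t - goodPart hadd hhom out k g t' = t - t' := by
      rw [← goodPart_sub, goodPart_of_mem hadd hhom out hmem]
    rw [insLinOfChannel_succ, insLinOfChannel_succ, ← insAtOfChannel_succ, ← insAtOfChannel_succ]
    refine norm_insAt_sub_le hadd hsum hsize hwt0 hwt hτ hc hω hrH (k + 1) g hD (fun Y hY u' => ?_) u
    have := congrFun hdiff (Y, u')
    simp only [Pi.sub_apply] at this
    rw [this]
    exact hb Y hY u'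

end Binders

/-! ## §1b Generic `StepModel` algebra: the size shapes contained in MI-3a -/

section Generic

variable {C' : Carriers} {Op' Hist' : Type*} [NormedAddCommGroup Op'] [NormedSpace ℂ Op'] [NormedAddCommGroup Hist'] [NormedSpace ℂ Hist']
  (M : StepModel C' Op' Hist') {W : Set (ℕ → ℝ)} {κ c ω : ℝ}

/-- [folklore] `SizeDampedNat` IS `InsertionDampedNat` against the zero table. -/
theorem stepModel_sizeDampedNat_of_insertionDampedNat (hdamp : M.InsertionDampedNat W κ c ω) : M.SizeDampedNat W κ c ω := by
  intro k g hg U t T hT hb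
  exact hdamp k g hg U t 0 T hT fun Y hY => by simpa only [Pi.zero_apply, sub_zero] using hb Y hY

/-- [folklore] The single-scale shape `InsScaleBoundLevel` is contained in `InsertionDampedNat` (second table `0`, levels `T·𝟙_{j}`). -/
theorem stepModel_insScaleBoundLevel_of_insertionDampedNat (hdamp : M.InsertionDampedNat W κ c ω) : M.InsScaleBoundLevel W κ c ω := by
  intro k g hg U t j T hj hT hsupp hlev
  have h := hdamp k g hg U t 0 (fun i => if i = j then T else 0) (fun i _ => by by_cases hi : i = j <;> simp [hi, hT])
    fun Y hY => by
      by_cases hYj : C'.scale Y = j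
      · simpa only [Pi.zero_apply, sub_zero, hYj, if_true] using hlev Y hYj
      · rw [hsupp Y hYj, Pi.zero_apply, sub_zero, abs_zero, if_neg hYj, zero_mul]
  simpa only [mul_ite, mul_zero, Finset.sum_ite_eq', Finset.mem_range, hj, if_true] using h

/-- [folklore] The fixed-level shape `InsScaleBound κ E₁` from the arbitrary-level one (`0 ≤ E₁`). -/
theorem stepModel_insScaleBound_of_insScaleBoundLevel {E₁ : ℝ} (hlevel : M.InsScaleBoundLevel W κ c ω) (hE₁ : 0 ≤ E₁) :
    M.InsScaleBound W κ E₁ c ω := fun k g hg U t j hj hsupp hlev => hlevel k g hg U t j E₁ hj hE₁ hsupp hlev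

end Generic

section BindersSlots

variable {T : ℕ → (ℕ → ℝ) → (𝒰 → C.Dom → ℝ) → ι → ℝ}
variable (hadd : ChannelAdditive (Set.univ : Set (𝒰 → C.Dom → ℝ)) T) (hhom : ChannelHomog (Set.univ : Set (𝒰 → C.Dom → ℝ)) T)
  (out : 𝒰 → F.Idx → ι)
variable {Op : Type*} [NormedAddCommGroup Op] [NormedSpace ℂ Op] (P : PointwiseSlots C 𝒰 Op (Hist F)) {W : Set (ℕ → ℝ)}

/-- [folklore] **`InsAffine` OF THE FAMILY MODEL — EXACT, ON ALL TABLES** — for per-background slots whose run-A insertion IS the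
linear-extension insertion on the window (`famOf` verbatim by `famOf_insLin_apply`, coordinatewise `insLin_affine_pointwise`).  This is the
structural binder part 2's `toy_not_insAffine` shows FAILS for the junk-valued insertion of the same channel. -/
theorem insAffine_of_insLin (hins : ∀ k, ∀ g ∈ W, ∀ (t : C.Dom × 𝒰 → ℝ) (u : 𝒰), P.insA g k t u = insLinOfChannel hadd hhom out g k t u) :
    P.toStepModel.InsAffine W := by
  intro k g hg _ t t'
  have hfun : ∀ s, P.insA g k s = insLinOfChannel hadd hhom out g k s := fun s => funext fun u => hins k g hg s u
  refine lp.ext (funext fun u => ?_)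
  show (⇑(famOf (P.insA g k t) - famOf (P.insA g k t'))) u = (⇑(famOf (P.insA g k (t - t')) - famOf (P.insA g k 0))) u
  simp only [lp.coeFn_sub, Pi.sub_apply, hfun, famOf_insLin_apply]
  exact insLin_affine_pointwise hadd hhom out g k t t' u

/-- [folklore] **`InsHomog` OF THE FAMILY MODEL — EXACT, ON ALL TABLES.** -/
theorem insHomog_of_insLin (hins : ∀ k, ∀ g ∈ W, ∀ (t : C.Dom × 𝒰 → ℝ) (u : 𝒰), P.insA g k t u = insLinOfChannel hadd hhom out g k t u) :
    P.toStepModel.InsHomog W := by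
  intro k g hg _ a t
  have hfun : ∀ s, P.insA g k s = insLinOfChannel hadd hhom out g k s := fun s => funext fun u => hins k g hg s u
  refine lp.ext (funext fun u => ?_)
  show (⇑(famOf (P.insA g k (a • t)) - famOf (P.insA g k 0))) u = (⇑((a : ℂ) • (famOf (P.insA g k t) - famOf (P.insA g k 0)))) u
  simp only [lp.coeFn_sub, lp.coeFn_smul, Pi.sub_apply, Pi.smul_apply, hfun, famOf_insLin_apply]
  exact insLin_homog_pointwise hadd hhom out g k a t u

/-- [folklore] **`InsBlind` OF THE FAMILY MODEL — EXACT** (`ChannelLocal univ T`). -/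
theorem insBlind_of_insLin (hins : ∀ k, ∀ g ∈ W, ∀ (t : C.Dom × 𝒰 → ℝ) (u : 𝒰), P.insA g k t u = insLinOfChannel hadd hhom out g k t u)
    (hloc : ChannelLocal (Set.univ : Set (𝒰 → C.Dom → ℝ)) T) : P.toStepModel.InsBlind W := by
  intro k g hg _ t t' h
  show famOf (P.insA g k t) = famOf (P.insA g k t')
  have : P.insA g k t = P.insA g k t' := funext fun u => by
    rw [hins k g hg t u, hins k g hg t' u]
    exact insLin_eq_of_agree hadd hhom out hloc g k (fun Y hY u => h (Y, u) hY) u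
  rw [this]

/-- [folklore] **THE PER-CHART-POINT MI-3a BINDER (Nat form)** for per-background slots reading the channel through the linear extension
— the same displayed inputs as part 1's `insertionDampedNat_pointwise_of_insAt`. -/
theorem insertionDampedNat_pointwise_of_insLin {κ c ω : ℝ} {wt : ℕ → ι → ℝ} {τ : ℕ → ℕ → ℝ}
    (hins : ∀ k, ∀ g ∈ W, ∀ (t : C.Dom × 𝒰 → ℝ) (u : 𝒰), P.insA g k t u = insLinOfChannel hadd hhom out g k t u)
    (hsum : ChannelStepSum (Set.univ : Set (𝒰 → C.Dom → ℝ)) T) (hsize : ChannelSizeAtStepNN (Set.univ : Set (𝒰 → C.Dom → ℝ)) T κ wt τ)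
    (hwt0 : ∀ k u i, 0 ≤ wt k (out u i)) (hwt : ∀ k u i, wt k (out u i) ≤ P.rHist (k + 1) * F.wt i)
    (hτ : ∀ k j, j ≤ k → τ k j ≤ c * ω ^ (k - j)) (hc : 0 ≤ c) (hω : 0 ≤ ω) :
    ∀ k, ∀ g ∈ W, ∀ (t t' : C.Dom × 𝒰 → ℝ) (D : ℕ → ℝ), (∀ j < k, 0 ≤ D j) →
      (∀ Y, C.scale Y < k → ∀ u, |t (Y, u) - t' (Y, u)| ≤ D (C.scale Y) * Real.exp (-(κ * C.d Y))) →
        ∀ u, ‖P.insA g k t u - P.insA g k t' u‖ ≤ P.rHist k * (c * ∑ j ∈ range k, ω ^ (k - 1 - j) * D j) := by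
  intro k g hg t t' D hD hb u
  rw [hins k g hg t u, hins k g hg t' u]
  exact norm_insLin_sub_le hadd hhom out hsum hsize hwt0 hwt hτ hc hω (fun k => (P.rHist_pos k).le) k g hD hb u

/-- [folklore] **THE SAME IN C0's NORMALISATION** (gain `c∕ω`, `0 < ω`) = the `hdamp` binder of `PointwiseSlots.ne5_of_pointwiseSlots`. -/
theorem insertionDamped_pointwise_of_insLin {κ c ω : ℝ} {wt : ℕ → ι → ℝ} {τ : ℕ → ℕ → ℝ}
    (hins : ∀ k, ∀ g ∈ W, ∀ (t : C.Dom × 𝒰 → ℝ) (u : 𝒰), P.insA g k t u = insLinOfChannel hadd hhom out g k t u)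
    (hsum : ChannelStepSum (Set.univ : Set (𝒰 → C.Dom → ℝ)) T) (hsize : ChannelSizeAtStepNN (Set.univ : Set (𝒰 → C.Dom → ℝ)) T κ wt τ)
    (hwt0 : ∀ k u i, 0 ≤ wt k (out u i)) (hwt : ∀ k u i, wt k (out u i) ≤ P.rHist (k + 1) * F.wt i)
    (hτ : ∀ k j, j ≤ k → τ k j ≤ c * ω ^ (k - j)) (hc : 0 ≤ c) (hω : 0 < ω) :
    ∀ k, ∀ g ∈ W, ∀ (t t' : C.Dom × 𝒰 → ℝ) (D : ℕ → ℝ), (∀ j < k, 0 ≤ D j) →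
      (∀ Y, C.scale Y < k → ∀ u, |t (Y, u) - t' (Y, u)| ≤ D (C.scale Y) * Real.exp (-(κ * C.d Y))) →
        ∀ u, ‖P.insA g k t u - P.insA g k t' u‖ ≤ P.rHist k * (c / ω * ∑ j ∈ range k, ω ^ (k - j) * D j) := by
  intro k g hg t t' D hD hb u
  rw [← mul_sum_age_shift hω.ne' c D]
  exact insertionDampedNat_pointwise_of_insLin hadd hhom out P hins hsum hsize hwt0 hwt hτ hc hω.le k g hg t t' D hD hb u

/-- [folklore] **MODEL LEVEL: `InsertionDampedNat` OF THE FAMILY MODEL** (nonempty chart). -/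
theorem insertionDampedNat_of_insLin [Nonempty 𝒰] {κ c ω : ℝ} {wt : ℕ → ι → ℝ} {τ : ℕ → ℕ → ℝ}
    (hins : ∀ k, ∀ g ∈ W, ∀ (t : C.Dom × 𝒰 → ℝ) (u : 𝒰), P.insA g k t u = insLinOfChannel hadd hhom out g k t u)
    (hsum : ChannelStepSum (Set.univ : Set (𝒰 → C.Dom → ℝ)) T) (hsize : ChannelSizeAtStepNN (Set.univ : Set (𝒰 → C.Dom → ℝ)) T κ wt τ)
    (hwt0 : ∀ k u i, 0 ≤ wt k (out u i)) (hwt : ∀ k u i, wt k (out u i) ≤ P.rHist (k + 1) * F.wt i)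
    (hτ : ∀ k j, j ≤ k → τ k j ≤ c * ω ^ (k - j)) (hc : 0 ≤ c) (hω : 0 ≤ ω) : P.toStepModel.InsertionDampedNat W κ c ω := by
  intro k g hg _ t t' D hD hb
  exact norm_famOf_sub_famOf_le
    (insertionDampedNat_pointwise_of_insLin hadd hhom out P hins hsum hsize hwt0 hwt hτ hc hω k g hg t t' D hD
      (fun Y hY u => hb (Y, u) hY))

/-- [folklore] **E1′ ON ROAD D FOR A CHANNEL-READING FAMILY MODEL** — the kernel's `StepModel.ne5_at_of_stepModel_fibre_scale_nat`
(the END face that CARRIES the structural binders `InsAffine ∧ InsBlind ∧ InsHomog` + the single-scale term `InsScaleBound κ E₁ c ω`)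
applied to leaf-02's per-background slots whose run-A insertion IS the linear-extension channel insertion: the three structural binders
from §1 (exact), the single-scale term (at the reference level `E₁ := 1`, idle here) from MI-3a by the generic algebra of §1b, representation ∕ admissibility ∕ W1 ∕ insertion rate
from their per-point forms (leaf-02's part-3 transfers), the two FIBRE envelopes as DISPLAYED model-level binders, the decay bounds over
`C` lifted; then `ne5_of_ne5_lift` (chart onto, nonempty).  Conclusion LITERALLY `T4OutputRate.NE5 EA EB W κ θ′ C₅` with E1′'s constant.
This is the face part 2's `toy_not_insAffine` shows UNUSABLE for the junk-valued insertion of the same channel. -/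
theorem ne5_of_pointwiseSlots_insLin_fibre_scale_nat [Nonempty 𝒰] {ρ : 𝒰 → C.BgB} (hρ : Function.Surjective ρ)
    {EA : T4OutputRate.Functional C C.BgA} {EB : T4OutputRate.Functional C C.BgB}
    {κ c ω G EA₀ E₀ δ δ' θ θ' ρ₀ B : ℝ} {k₀ : ℕ} {wt : ℕ → ι → ℝ} {τ : ℕ → ℕ → ℝ}
    (hbdA : ∀ g ∈ W, ∀ k, BddAbove (Set.range fun u => ‖P.insA g k (uncurry (funTableA ρ EA g)) u‖))
    (hbdB : ∀ g ∈ W, ∀ k, BddAbove (Set.range fun u => ‖P.insB g k (uncurry (funTableB ρ EB g)) u‖))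
    (hrA : ∀ g ∈ W, ∀ (X : C.Dom) (u : 𝒰), EA g (C.transport (ρ u)) X =
      (P.Out (C.scale X) (P.opA g (C.scale X) u) (P.insA g (C.scale X) (uncurry (funTableA ρ EA g)) u) X).re)
    (hrB : ∀ g ∈ W, ∀ (X : C.Dom) (u : 𝒰), EB g (ρ u) X =
      (P.Out (C.scale X) (P.opB g (C.scale X) u) (P.insB g (C.scale X) (uncurry (funTableB ρ EB g)) u) X).re)
    (hbase : ∀ k, ∀ g ∈ W, ∀ u, (P.opB g k u, P.insB g k (uncurry (funTableB ρ EB g)) u) ∈ P.Base k g u)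
    (hopF : P.toStepModel.OpFibreEnvelope W κ G) (hhistF : P.toStepModel.HistFibreEnvelope W κ G)
    (hdA : T4OutputRate.DecayBound EA W EA₀ κ) (hdB : T4OutputRate.DecayBound EB W E₀ κ)
    (hop : ∀ k, ∀ g ∈ W, ∀ u : 𝒰, ‖P.opA g k u - P.opB g k u‖ ≤ δ * θ ^ k * P.rOp k)
    (hinsRate : ∀ k, ∀ g ∈ W, ∀ (t : C.Dom × 𝒰 → ℝ), (∀ Y u, |t (Y, u)| ≤ E₀ * Real.exp (-(κ * C.d Y))) →
      ∀ u, ‖P.insA g k t u - P.insB g k t u‖ ≤ δ' * θ ^ k * P.rHist k)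
    (hins : ∀ k, ∀ g ∈ W, ∀ (t : C.Dom × 𝒰 → ℝ) (u : 𝒰), P.insA g k t u = insLinOfChannel hadd hhom out g k t u)
    (hloc : ChannelLocal (Set.univ : Set (𝒰 → C.Dom → ℝ)) T) (hsum : ChannelStepSum (Set.univ : Set (𝒰 → C.Dom → ℝ)) T)
    (hsize : ChannelSizeAtStepNN (Set.univ : Set (𝒰 → C.Dom → ℝ)) T κ wt τ) (hwt0 : ∀ k u i, 0 ≤ wt k (out u i))
    (hwt : ∀ k u i, wt k (out u i) ≤ P.rHist (k + 1) * F.wt i) (hτ : ∀ k j, j ≤ k → τ k j ≤ c * ω ^ (k - j))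
    (hG : 0 ≤ G) (hδ : 0 ≤ δ + δ') (hθ : 0 ≤ θ) (hθθ' : θ ≤ θ') (hθ'1 : θ' ≤ 1) (hc : 0 ≤ c) (hω : 0 < ω)
    (hρ₀ : ρ₀ < 1) (hnear : (δ + δ') * θ ^ k₀ + c * (EA₀ + E₀) / (1 - ω) ≤ ρ₀) (hB : 0 ≤ B)
    (hfirst : ∀ k < k₀, EA₀ + E₀ ≤ B * θ ^ k) (hsmall : ω + G / (1 - ρ₀) * c < θ') :
    T4OutputRate.NE5 EA EB W κ θ' ((G / (1 - ρ₀) * (δ + δ') + B) * (θ' - ω) / (θ' - (ω + G / (1 - ρ₀) * c))) :=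
  have hdamp := insertionDampedNat_of_insLin hadd hhom out P hins hsum hsize hwt0 hwt hτ hc hω.le
  ne5_of_ne5_lift hρ (P.toStepModel.ne5_at_of_stepModel_fibre_scale_nat (P.representsA_of_pointwise hbdA hrA)
    (P.representsB_of_pointwise hbdB hrB) (P.inBase_of_pointwise hbdB hbase) hopF hhistF (decayBound_liftA_of ρ hdA)
    (decayBound_liftB_of ρ hdB) (P.operatorRate_of_pointwise hop) (P.insertionRate_of_pointwise hinsRate)
    (insAffine_of_insLin hadd hhom out P hins) (insBlind_of_insLin hadd hhom out P hins hloc) (insHomog_of_insLin hadd hhom out P hins)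
    (stepModel_insScaleBound_of_insScaleBoundLevel _ (stepModel_insScaleBoundLevel_of_insertionDampedNat _ hdamp) zero_le_one)
    one_pos hG hδ hθ hθθ' hθ'1 hc hω hρ₀ hnear hB hfirst hsmall)

end BindersSlots

/-! ## §2 Toy: the SAME channel as part 2's, through the linear extension — `InsAffine` now HOLDS -/

section Toy

/-- [folklore] Part 2's toy channel is homogeneous on all families. -/
theorem toyChannel_homog : ChannelHomog (Set.univ : Set (ℕ → toyCarriers.Dom → ℝ)) toyChannel := by
  intro k s H _ a y
  show (if y.1 ≤ k then (a • H) y.2 y.1 else 0) = a * (if y.1 ≤ k then H y.2 y.1 else 0)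
  by_cases h : y.1 ≤ k
  · rw [if_pos h, if_pos h]; rfl
  · rw [if_neg h, if_neg h, mul_zero]

/-- [folklore] DATA: part 2's toy slots with the LINEAR-EXTENSION insertion of the same channel (infinite chart `ℕ`). -/
def toySlotsLin : PointwiseSlots toyCarriers ℕ ℂ (Hist toyFrame) where
  Out _ _ _ _ := 0
  opA _ _ _ := 0
  opB _ _ _ := 0
  insA g k t u := insLinOfChannel toyChannel_additive toyChannel_homog toyOut g k t u
  insB g k t u := insLinOfChannel toyChannel_additive toyChannel_homog toyOut g k t u
  Base _ _ _ := Set.univ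
  rOp _ := 1
  rHist _ := 1
  rOp_pos _ := one_pos
  rHist_pos _ := one_pos
  opA_bdd _ _ := ⟨0, by rintro _ ⟨u, rfl⟩; simp⟩
  opB_bdd _ _ := ⟨0, by rintro _ ⟨u, rfl⟩; simp⟩

/-- [folklore] **`InsAffine` HOLDS for the linear-extension insertion of the toy channel** — contrast part 2's `toy_not_insAffine` for the
junk-valued insertion of the SAME channel over the SAME infinite chart. -/
theorem toySlotsLin_insAffine : toySlotsLin.toStepModel.InsAffine (Set.univ : Set (ℕ → ℝ)) :=
  insAffine_of_insLin toyChannel_additive toyChannel_homog toyOut toySlotsLin fun _ _ _ _ _ => rfl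

/-- [folklore] … together with `InsHomog`, `InsBlind` and MI-3a (`κ = 0`, `c = 1`, `ω = 1`). -/
theorem toySlotsLin_binders :
    toySlotsLin.toStepModel.InsHomog (Set.univ : Set (ℕ → ℝ)) ∧ toySlotsLin.toStepModel.InsBlind (Set.univ : Set (ℕ → ℝ)) ∧
      toySlotsLin.toStepModel.InsertionDampedNat (Set.univ : Set (ℕ → ℝ)) 0 1 1 :=
  ⟨insHomog_of_insLin toyChannel_additive toyChannel_homog toyOut toySlotsLin fun _ _ _ _ _ => rfl,
    insBlind_of_insLin toyChannel_additive toyChannel_homog toyOut toySlotsLin (fun _ _ _ _ _ => rfl) toyChannel_local,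
    insertionDampedNat_of_insLin toyChannel_additive toyChannel_homog toyOut toySlotsLin (fun _ _ _ _ _ => rfl) toyChannel_stepSum
      toyChannel_size (fun _ _ _ => zero_le_one) (fun _ _ _ => by show (1 : ℝ) ≤ 1 * 1; rw [mul_one])
      (fun k j _ => by rw [one_pow, mul_one]) zero_le_one zero_le_one⟩

end Toy

end Summit.QuantumFields.BalabanUV.T4Continuum.InsertionChannelFamily

end
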